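import Summits.Ventures.HodgeRepro2.T5HeckeSelfAdjoint
import Summits.Ventures.HodgeRepro2.T5HeckeCommutativeMultiplicityOne

/-!
# T5CartanWeylInverse — Gelfand's trick from a Cartan decomposition with `−1` in the Weyl group

Blind cell pub-hodge-repro2, seat p8, Tier-5 kernel support. CHECK-N3 §19.1 row 5 leaves, for the INERT
places of the record, the cell «the Cartan decomposition of a unitary group for hyperspecial `K` and the `−1`
of its relative Weyl group» in prose. This file puts the SECOND half in the kernel, for an arbitrary group:

* if `G = K·A·K` for a set `A` of representatives (`hcartan`) and every `a ∈ A` satisfies `a⁻¹ ∈ K a K`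
  (`hA`) — in particular if a single `w ∈ K` satisfies `w * a * w⁻¹ = a⁻¹` for all `a ∈ A`, the element of
  `N_K(A)` acting as `−1` on the torus — then `g⁻¹ ∈ K g K` for EVERY `g ∈ G`
  (`exists_inv_eq_mul_mul_of_cartan`, `inv_mem_orbit_of_cartan`);
* this is exactly the hypothesis `hinv` of the inversion form of Gelfand's trick (T5HeckeGelfandTrick), so
  `H(G,K)` is commutative whenever all `KgK/K` are finite (`heckeAlgebra_mul_comm_of_cartan`);
* `K g⁻¹ K = K g K` (`orbit_inv_eq_of_cartan`), hence the counting form of unimodularity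
  `#(Kg⁻¹K/K) = #(KgK/K)` (`ncard_orbit_inv_eq_of_cartan`), `T_{g⁻¹} = T_g` (`doubleCosetOp_inv_eq_of_cartan`),
  the self-adjointness of every `T_g` for a `G`-invariant hermitian form (`apply_heckeSMul_doubleCosetOp_self_of_cartan`,
  from T5HeckeSelfAdjoint) and multiplicity one of the spherical line for an irreducible `K`-finite representation
  (`finrank_invariants_eq_one_of_cartan`, from T5HeckeCommutativeMultiplicityOne).

The Cartan decomposition itself is a HYPOTHESIS of every statement here. For `GL_n` over a DVR it is
T5CartanUniformiser (where `−1` is NOT in the Weyl group and the transpose is used instead, T5CartanTransposeGelfand);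
for the unitary groups of the record at the inert places it is the printed Bruhat–Tits statement, consumed as a
hypothesis in T5UnitaryGroupForm. Nothing about a specific group is asserted. No definitions (proof lane).
-/

namespace Summit.Ventures.HodgeRepro2.T5CartanWeylInverse

open Summit.Ventures.HodgeRepro2

variable {G : Type*} [Group G] {K : Subgroup G} {A : Set G}

/-- If `g = k₁ * a * k₂` and `a⁻¹ = κ₁ * a * κ₂`, then `g⁻¹ = (k₂⁻¹ κ₁ k₁⁻¹) * g * (k₂⁻¹ κ₂ k₁⁻¹)`:
the double coset of `g⁻¹` is determined by that of `a⁻¹`. -/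
theorem inv_eq_mul_mul_of_eq_mul_mul {g a k₁ k₂ κ₁ κ₂ : G} (hg : g = k₁ * a * k₂)
    (ha : a⁻¹ = κ₁ * a * κ₂) :
    g⁻¹ = (k₂⁻¹ * κ₁ * k₁⁻¹) * g * (k₂⁻¹ * κ₂ * k₁⁻¹) := by
  subst hg
  calc (k₁ * a * k₂)⁻¹ = k₂⁻¹ * a⁻¹ * k₁⁻¹ := by group
    _ = k₂⁻¹ * (κ₁ * a * κ₂) * k₁⁻¹ := by rw [ha]
    _ = (k₂⁻¹ * κ₁ * k₁⁻¹) * (k₁ * a * k₂) * (k₂⁻¹ * κ₂ * k₁⁻¹) := by group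

/-- Cartan decomposition `G = K·A·K` and `a⁻¹ ∈ K a K` for every `a ∈ A` give `g⁻¹ ∈ K g K` for every `g`
(set form: `g⁻¹ = κ₁ * g * κ₂` with `κ₁, κ₂ ∈ K`). -/
theorem exists_inv_eq_mul_mul_of_cartan
    (hcartan : ∀ g : G, ∃ k₁ ∈ K, ∃ a ∈ A, ∃ k₂ ∈ K, g = k₁ * a * k₂)
    (hA : ∀ a ∈ A, ∃ κ₁ ∈ K, ∃ κ₂ ∈ K, a⁻¹ = κ₁ * a * κ₂) (g : G) :
    ∃ κ₁ ∈ K, ∃ κ₂ ∈ K, g⁻¹ = κ₁ * g * κ₂ := by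
  obtain ⟨k₁, hk₁, a, ha, k₂, hk₂, hg⟩ := hcartan g
  obtain ⟨κ₁, hκ₁, κ₂, hκ₂, hai⟩ := hA a ha
  exact ⟨k₂⁻¹ * κ₁ * k₁⁻¹, mul_mem (mul_mem (inv_mem hk₂) hκ₁) (inv_mem hk₁),
    k₂⁻¹ * κ₂ * k₁⁻¹, mul_mem (mul_mem (inv_mem hk₂) hκ₂) (inv_mem hk₁),
    inv_eq_mul_mul_of_eq_mul_mul hg hai⟩

/-- The Weyl-element form of the hypothesis on `A`: a single `w ∈ K` with `w * a * w⁻¹ = a⁻¹` for all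
`a ∈ A` (the `−1` of the relative Weyl group realised inside `K`) gives `a⁻¹ ∈ K a K` for all `a ∈ A`. -/
theorem exists_inv_eq_mul_mul_of_weyl {w : G} (hw : w ∈ K) (hwA : ∀ a ∈ A, w * a * w⁻¹ = a⁻¹) :
    ∀ a ∈ A, ∃ κ₁ ∈ K, ∃ κ₂ ∈ K, a⁻¹ = κ₁ * a * κ₂ :=
  fun a ha => ⟨w, hw, w⁻¹, inv_mem hw, (hwA a ha).symm⟩

/-- Orbit form of the conclusion, in `G ⧸ K`: `↑g⁻¹ ∈ MulAction.orbit K ↑g` — the hypothesis `hinv` of the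
inversion form of Gelfand's trick (T5HeckeGelfandTrick). -/
theorem inv_mem_orbit_of_cartan
    (hcartan : ∀ g : G, ∃ k₁ ∈ K, ∃ a ∈ A, ∃ k₂ ∈ K, g = k₁ * a * k₂)
    (hA : ∀ a ∈ A, ∃ κ₁ ∈ K, ∃ κ₂ ∈ K, a⁻¹ = κ₁ * a * κ₂) (g : G) :
    (↑g⁻¹ : G ⧸ K) ∈ MulAction.orbit K (↑g : G ⧸ K) := by
  rw [T5HeckeGelfandTrick.mem_orbit_iff_exists_mul_mul]
  exact exists_inv_eq_mul_mul_of_cartan hcartan hA g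

/-- The same with the Weyl element `w`. -/
theorem inv_mem_orbit_of_weyl
    (hcartan : ∀ g : G, ∃ k₁ ∈ K, ∃ a ∈ A, ∃ k₂ ∈ K, g = k₁ * a * k₂)
    {w : G} (hw : w ∈ K) (hwA : ∀ a ∈ A, w * a * w⁻¹ = a⁻¹) (g : G) :
    (↑g⁻¹ : G ⧸ K) ∈ MulAction.orbit K (↑g : G ⧸ K) :=
  inv_mem_orbit_of_cartan hcartan (exists_inv_eq_mul_mul_of_weyl hw hwA) g

/-- `K g⁻¹ K = K g K` (as `K`-orbits in `G ⧸ K`). -/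
theorem orbit_inv_eq_of_cartan
    (hcartan : ∀ g : G, ∃ k₁ ∈ K, ∃ a ∈ A, ∃ k₂ ∈ K, g = k₁ * a * k₂)
    (hA : ∀ a ∈ A, ∃ κ₁ ∈ K, ∃ κ₂ ∈ K, a⁻¹ = κ₁ * a * κ₂) (g : G) :
    MulAction.orbit K (↑g⁻¹ : G ⧸ K) = MulAction.orbit K (↑g : G ⧸ K) :=
  MulAction.orbit_eq_iff.mpr (inv_mem_orbit_of_cartan hcartan hA g)

/-- The counting form of unimodularity `#(Kg⁻¹K/K) = #(KgK/K)` (the hypothesis `hU` of T5HeckeAdjoint /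
T5HeckeAdjointHermitian / T5HeckeSelfAdjoint) holds under a Cartan decomposition with `−1` in the Weyl group. -/
theorem ncard_orbit_inv_eq_of_cartan
    (hcartan : ∀ g : G, ∃ k₁ ∈ K, ∃ a ∈ A, ∃ k₂ ∈ K, g = k₁ * a * k₂)
    (hA : ∀ a ∈ A, ∃ κ₁ ∈ K, ∃ κ₂ ∈ K, a⁻¹ = κ₁ * a * κ₂) (g : G) :
    (MulAction.orbit K (↑g⁻¹ : G ⧸ K)).ncard = (MulAction.orbit K (↑g : G ⧸ K)).ncard := by
  rw [orbit_inv_eq_of_cartan hcartan hA g]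

/-- Finiteness of `Kg⁻¹K/K` follows from that of `KgK/K`. -/
theorem finite_orbit_inv_of_cartan
    (hcartan : ∀ g : G, ∃ k₁ ∈ K, ∃ a ∈ A, ∃ k₂ ∈ K, g = k₁ * a * k₂)
    (hA : ∀ a ∈ A, ∃ κ₁ ∈ K, ∃ κ₂ ∈ K, a⁻¹ = κ₁ * a * κ₂) (g : G)
    [Finite (MulAction.orbit K (↑g : G ⧸ K))] :
    Finite (MulAction.orbit K (↑g⁻¹ : G ⧸ K)) := by
  rw [orbit_inv_eq_of_cartan hcartan hA g]; infer_instance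

section Hecke

variable (k : Type*) [Field k]

/-- GELFAND'S TRICK FROM A CARTAN DECOMPOSITION: if all `KgK/K` are finite, `G = K·A·K` and `a⁻¹ ∈ K a K`
for every `a ∈ A`, then the Hecke algebra `H(G,K)` is commutative. -/
theorem heckeAlgebra_mul_comm_of_cartan (hfin : ∀ g : G, Finite (MulAction.orbit K (↑g : G ⧸ K)))
    (hcartan : ∀ g : G, ∃ k₁ ∈ K, ∃ a ∈ A, ∃ k₂ ∈ K, g = k₁ * a * k₂)
    (hA : ∀ a ∈ A, ∃ κ₁ ∈ K, ∃ κ₂ ∈ K, a⁻¹ = κ₁ * a * κ₂)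
    (T S : T5HeckePermutationModule.heckeAlgebra k K) : T * S = S * T :=
  T5HeckeGelfandTrick.mul_comm_of_inv_mem_orbit hfin (inv_mem_orbit_of_cartan hcartan hA) T S

/-- The same with the Weyl element `w ∈ K`, `w * a * w⁻¹ = a⁻¹` on `A`. -/
theorem heckeAlgebra_mul_comm_of_weyl (hfin : ∀ g : G, Finite (MulAction.orbit K (↑g : G ⧸ K)))
    (hcartan : ∀ g : G, ∃ k₁ ∈ K, ∃ a ∈ A, ∃ k₂ ∈ K, g = k₁ * a * k₂)
    {w : G} (hw : w ∈ K) (hwA : ∀ a ∈ A, w * a * w⁻¹ = a⁻¹)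
    (T S : T5HeckePermutationModule.heckeAlgebra k K) : T * S = S * T :=
  heckeAlgebra_mul_comm_of_cartan k hfin hcartan (exists_inv_eq_mul_mul_of_weyl hw hwA) T S

/-- `T_{g⁻¹} = T_g` in `H(G,K)` under a Cartan decomposition with `−1` in the Weyl group. -/
theorem doubleCosetOp_inv_eq_of_cartan (hfin : ∀ g : G, Finite (MulAction.orbit K (↑g : G ⧸ K)))
    (hcartan : ∀ g : G, ∃ k₁ ∈ K, ∃ a ∈ A, ∃ k₂ ∈ K, g = k₁ * a * k₂)
    (hA : ∀ a ∈ A, ∃ κ₁ ∈ K, ∃ κ₂ ∈ K, a⁻¹ = κ₁ * a * κ₂) (g : G) :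
    haveI := hfin g
    haveI := hfin g⁻¹
    T5HeckeDoubleCoset.doubleCosetOp k K g⁻¹ = T5HeckeDoubleCoset.doubleCosetOp k K g := by
  haveI := hfin g
  haveI := hfin g⁻¹
  exact T5HeckeSelfAdjoint.doubleCosetOp_inv_eq g (inv_mem_orbit_of_cartan hcartan hA g)

variable {k}

/-- THE HECKE OPERATORS ARE SELF-ADJOINT: for a `G`-invariant hermitian form `B` on a representation `ρ`,
`B(T_g v, w) = B(v, T_g w)` on `ρ^K`, under a Cartan decomposition with `−1` in the Weyl group
(T5HeckeSelfAdjoint with `hinv` and `hU` discharged). -/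
theorem apply_heckeSMul_doubleCosetOp_self_of_cartan [StarRing k] {V : Type*} [AddCommGroup V] [Module k V]
    {ρ : Representation k G V} (hfin : ∀ g : G, Finite (MulAction.orbit K (↑g : G ⧸ K)))
    {B : V →ₗ⋆[k] V →ₗ[k] k} (hB : T5HeckeAdjointHermitian.IsInvariantSesq ρ B)
    (hH : T5HeckeAdjointHermitian.IsHermitian B)
    (hcartan : ∀ g : G, ∃ k₁ ∈ K, ∃ a ∈ A, ∃ k₂ ∈ K, g = k₁ * a * k₂)
    (hA : ∀ a ∈ A, ∃ κ₁ ∈ K, ∃ κ₂ ∈ K, a⁻¹ = κ₁ * a * κ₂) (g : G)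
    (v w : LevelPositivity.invariants ρ K) :
    B (T5HeckePermutationModule.heckeSMul ρ (T5HeckeDoubleCoset.doubleCosetOp k K g) v) w =
      B v (T5HeckePermutationModule.heckeSMul ρ (T5HeckeDoubleCoset.doubleCosetOp k K g) w) :=
  T5HeckeSelfAdjoint.apply_heckeSMul_doubleCosetOp_self hfin hB hH g (inv_mem_orbit_of_cartan hcartan hA g)
    (ncard_orbit_inv_eq_of_cartan hcartan hA g) v w

/-- `B(T v, w) = B(v, T̄ w)` for every `T ∈ H(G,K)` (`T̄` the coefficientwise conjugate of T5HeckeStar)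
under a Cartan decomposition with `−1` in the Weyl group. -/
theorem apply_heckeSMul_eq_apply_heckeSMul_conjOp_of_cartan [StarRing k] {V : Type*} [AddCommGroup V]
    [Module k V] {ρ : Representation k G V} (hfin : ∀ g : G, Finite (MulAction.orbit K (↑g : G ⧸ K)))
    (hcartan : ∀ g : G, ∃ k₁ ∈ K, ∃ a ∈ A, ∃ k₂ ∈ K, g = k₁ * a * k₂)
    (hA : ∀ a ∈ A, ∃ κ₁ ∈ K, ∃ κ₂ ∈ K, a⁻¹ = κ₁ * a * κ₂)
    {B : V →ₗ⋆[k] V →ₗ[k] k} (hB : T5HeckeAdjointHermitian.IsInvariantSesq ρ B)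
    (hH : T5HeckeAdjointHermitian.IsHermitian B) (T : T5HeckePermutationModule.heckeAlgebra k K)
    (v w : LevelPositivity.invariants ρ K) :
    B (T5HeckePermutationModule.heckeSMul ρ T v) w =
      B v (T5HeckePermutationModule.heckeSMul ρ (T5HeckeStar.conjOp T) w) :=
  T5HeckeSelfAdjoint.apply_heckeSMul_eq_apply_heckeSMul_conjOp hfin (ncard_orbit_inv_eq_of_cartan hcartan hA)
    (inv_mem_orbit_of_cartan hcartan hA) hB hH T v w

/-- MULTIPLICITY ONE OF THE SPHERICAL LINE under a Cartan decomposition with `−1` in the Weyl group: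
for `k` algebraically closed of characteristic `0`, an irreducible `K`-finite representation `ρ` with
`ρ^K ≠ 0` finite-dimensional has `dim ρ^K = 1` (T5HeckeCommutativeMultiplicityOne with `hcomm` discharged). -/
theorem finrank_invariants_eq_one_of_cartan [CharZero k] [IsAlgClosed k] {V : Type*} [AddCommGroup V]
    [Module k V] (ρ : Representation k G V) [ρ.IsIrreducible] (hKF : T5LevelIdempotent.KFinite ρ K)
    (hfin : ∀ g : G, Finite (MulAction.orbit K (↑g : G ⧸ K)))
    [FiniteDimensional k (LevelPositivity.invariants ρ K)] (hne : LevelPositivity.invariants ρ K ≠ ⊥)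
    (hcartan : ∀ g : G, ∃ k₁ ∈ K, ∃ a ∈ A, ∃ k₂ ∈ K, g = k₁ * a * k₂)
    (hA : ∀ a ∈ A, ∃ κ₁ ∈ K, ∃ κ₂ ∈ K, a⁻¹ = κ₁ * a * κ₂) :
    Module.finrank k (LevelPositivity.invariants ρ K) = 1 :=
  T5HeckeCommutativeMultiplicityOne.finrank_invariants_eq_one ρ hKF hfin hne
    (heckeAlgebra_mul_comm_of_cartan k hfin hcartan hA)

end Hecke

end Summit.Ventures.HodgeRepro2.T5CartanWeylInverse
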